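import Summits.AnomalousDissipation.AnomalousDissipation.Theorems.BaireTransferRobustLoudUpgradeCategoryPeriodicGeneric

/-!
# A route-level door from genericity: GENERIC dense loud designer forces give the Baire target with no upgrade crux
# (crux `BaireTransfer.RobustLoudUpgrade`, stmt-AnomalousDissipation-1144; line `malkin-cone-group-orbits`, lead c16)

Sequel of `…CategoryPeriodicGeneric.lean`.  Let `G(S) ⊆ P_S` be the residual, dense, BUDGET-FREE and LEVEL-FREE generic set of
`Tempered.loud_inter_generic_subset_interior` (on it every loud force is an interior point of every strictly relaxed loud set).  Then crux #2
of the route (`DenseLoudDesignerForces`: loud designer forces dense in an open `U` at every level) with the ONE extra word "generic" — the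
level-`j` designer forces near `U` are taken in `G(S)` — already gives the route's target `BaireTarget` (budgets relaxed by 2), with no
`RobustLoudUpgrade`, no nondegeneracy and no tempering: `U ⊆ closure (LOUD_j ∩ G) ⊆ closure (interior LOUD_j(2E,ε/2))`.

* `closure_interior_of_dense_generic_loud` — the `S`-wise statement with the generic set produced existentially;
* `baireTarget_of_denseGenericLoud` — the door: "generic dense loud designer forces ⇒ `BaireTarget`".

This is the genericity twin of the census's doors R2 (tame designer witnesses, `WildResidual.baireTarget_of_dense_tame`) and R5 (tempered
designer witnesses, `Tempered.baireTarget_of_denseLatticeTempered`): R2 asks the construction for spectral information, R5 for uniform bounds,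
this one only that the designer FORCES avoid a fixed meagre subset of `P_S` depending on `S` alone.
-/

set_option linter.dupNamespace false

noncomputable section

open scoped BigOperators Topology ENNReal NNReal ComplexConjugate
open Filter Set Function TopologicalSpace MeasureTheory UnitAddTorus

namespace Summit.AnomalousDissipation.AnomalousDissipation.Theorems.RobustLoudUpgrade.Tempered

open Summit.AnomalousDissipation.AnomalousDissipation.Theses.BaireTransfer

/-- **Dense GENERIC loudness upgrades for free**: for every `S` there is a residual dense `G ⊆ P_S` (budget- and level-free) such that
whenever the loud forces lying in `G` are dense in an open `U` at level `j` with budgets `(E, ε)`, `0 < E`, `0 < ε`, then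
`U ⊆ closure (interior LOUD_j(S,2E,ε/2))`. [folklore] -/
theorem closure_interior_of_dense_generic_loud : ∀ (S : Finset (Fin 3 → ℤ)), ∃ G : Set (Coeff S), G ∈ residual (Coeff S) ∧ Dense G ∧
    ∀ (a E ε : ℝ), 0 < E → 0 < ε → ∀ U : Set (Coeff S), U ⊆ closure (loud S a E ε ∩ G) →
      U ⊆ closure (interior (loud S a (2 * E) (ε / 2))) := by
  intro S
  obtain ⟨G, hG, hGd, h⟩ := closure_loud_inter_generic_subset S
  exact ⟨G, hG, hGd, fun a E ε hE hε U hU => hU.trans (h a E (2 * E) ε (ε / 2) (by linarith) (by linarith))⟩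

/-- **THE DOOR: generic dense loud designer forces ⇒ `BaireTarget`.**  If for some family `S`, budgets `0 < E`, `0 < ε` and a non-empty open
`U ⊆ P_S`, at every level `j` the level-`j` loud forces lying in the generic set `G(S)` are dense in `U` (crux #2 with generic designer forces),
then the route's target holds (with `S`, budgets `2E, ε/2`, and `U`).  Stated with the generic set produced existentially: the hypothesis is
required for EVERY residual dense `G` — in particular for `G(S)`. [folklore] -/
theorem baireTarget_of_denseGenericLoud
    (h : ∃ (S : Finset (Fin 3 → ℤ)) (E ε : ℝ), 0 < E ∧ 0 < ε ∧ ∃ U : Set (Coeff S), IsOpen U ∧ U.Nonempty ∧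
      ∀ G : Set (Coeff S), G ∈ residual (Coeff S) → Dense G →
        ∀ j : ℕ, U ⊆ closure (loud S (1 / ((j : ℝ) + 1)) E ε ∩ G)) :
    BaireTarget := by
  obtain ⟨S, E, ε, hE, hε, U, hUo, hUne, hU⟩ := h
  obtain ⟨G, hG, hGd, hcl⟩ := closure_interior_of_dense_generic_loud S
  refine ⟨S, 2 * E, ε / 2, by linarith, U, hUo, hUne, fun j => ?_⟩
  exact hcl (1 / ((j : ℝ) + 1)) E ε hE hε U (hU G hG hGd j)

end Summit.AnomalousDissipation.AnomalousDissipation.Theorems.RobustLoudUpgrade.Tempered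

end
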